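import Summits.BirchSwinnertonDyer.BirchSwinnertonDyer.Theorems.EdixhovenFibreFiveSevenStarredOptimalManinUnitFiveSevenHcorPrimeSquare
import HarnessLib

set_option autoImplicit false
-- the sub-problem namespace `Summit.BirchSwinnertonDyer.BirchSwinnertonDyer` duplicates a component by design (D-0017)
set_option linter.dupNamespace false

/-!
# K★ line `cdt_thm1`, stub `stub_hcor_invariant`: reduction of the whole stub to block certificates

Crux `StarredOptimalManinUnitFiveSeven` (stmt-BirchSwinnertonDyer-22226); skeleton v17 has the single stub
`stub_hcor_invariant`.  This file makes the residue of the stub formally precise.  A **block certificate at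
`ℓ^e`** (`ℓ` prime, `e ≥ 1`) is the statement: for every `m'` prime to `ℓ` and every `SL₂(ℤ)`-invariant
`θ : Γ(m'ℓ^e) → Q` of `ℓ`-power exponent, `θ` kills `Γ(m'ℓ^e) ∩ ([Γ(m'), Γ(m')] · K_θ)` (the local condition for
`Γ(m')`; = the `ℓ`-part of the Schur multiplier of `SL₂(ℤ/ℓ^e)` vanishes in the central extensions realised by
`SL₂(ℤ)`).  The tree has the certificates for `e = 1` (all `ℓ`) and `e = 2` (`ℓ` odd).

* `local_Gamma_of_squarefree_mul_block` — block/divisor induction: a certificate for the block `B` at level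
  `N = m·B` (`m` squarefree, prime to `B`) gives the local condition for every `Γ(c)`, `c ∣ m`;
* `cor453_invariant_form_of_block_certificates_exponent` — for `Q` of exponent `ℓ^a`: if block certificates at
  `ℓ^e` hold for all `3 ≤ e` (and `ℓ` is odd, or `4 ∤ N`), every invariant `θ : Γ(N) → Q` kills `Γ(12N)`;
* `cor453_invariant_form_of_odd_block_certificates` — **for every `N` with `4 ∤ N` and every finite commutative
  `Q`: the invariant form of CDT Cor. 4.5.3 (`θ` kills `Γ(12N)`) follows from the odd block certificates at
  `p^e`, `e ≥ 3`, `p ∣ |Q|`, `p^e ∣ N`**; `stub_hcor_invariant_of_odd_block_certificates` (the stub's shape).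

So `stub_hcor_invariant` = [odd block certificates, `e ≥ 3`] + [the `2`-adic levels `4 ∣ N`] ([Beyl1986]:
both hold).  K★ / Manin / BSD are not proved.
-/

open scoped MatrixGroups commutatorElement

universe u

namespace Summit.BirchSwinnertonDyer.BirchSwinnertonDyer.Theorems

namespace HcorBlocks

open CongruenceSubgroup Matrix.SpecialLinearGroup ModularGroup
open Literature.NumberTheory.Automorphic.UnboundedDenominators

/-- `Γ(L) ≤ Γ(M)` for `M ∣ L`. [folklore] -/
private theorem Gamma_le_Gamma_of_dvd₉ {M L : ℕ} (h : M ∣ L) : Gamma L ≤ Gamma M := by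
  intro γ hγ
  obtain ⟨h00, h01, h10, h11⟩ := Gamma_mem.mp hγ
  have cast_eq : ∀ a : ℤ, ((a : ZMod L).cast : ZMod M) = (a : ZMod M) := fun a ↦
    ZMod.cast_intCast h a
  rw [Gamma_mem]
  refine ⟨?_, ?_, ?_, ?_⟩
  · rw [← cast_eq, h00, ZMod.cast_one h]
  · rw [← cast_eq, h01, ZMod.cast_zero]
  · rw [← cast_eq, h10, ZMod.cast_zero]
  · rw [← cast_eq, h11, ZMod.cast_one h]

/-- The transfer step with the level as a variable. [cite: CalegariDimitrovTang2025, Corollary 4.5.3] -/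
private theorem transfer_step₃ {Q : Type*} [CommGroup Q] {N M p e M₀ : ℕ} [NeZero M] (hN : N = M * p)
    (hp : p.Prime) (hpM : p ∣ M) (hcop : e.Coprime p) (hQ : ∀ q : Q, q ^ e = 1)
    (hM : ∀ ψ : Gamma M →* Q,
      (∀ (g x : SL(2, ℤ)) (hx : x ∈ Gamma M) (hgx : g * x * g⁻¹ ∈ Gamma M),
        ψ ⟨g * x * g⁻¹, hgx⟩ = ψ ⟨x, hx⟩) →
      ∀ (x : SL(2, ℤ)) (hx : x ∈ Gamma M), x ∈ Gamma M₀ → ψ ⟨x, hx⟩ = 1)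
    (θ : Gamma N →* Q)
    (hθ : ∀ (g x : SL(2, ℤ)) (hx : x ∈ Gamma N) (hgx : g * x * g⁻¹ ∈ Gamma N),
      θ ⟨g * x * g⁻¹, hgx⟩ = θ ⟨x, hx⟩) :
    ∀ (x : SL(2, ℤ)) (hx : x ∈ Gamma N), x ∈ Gamma M₀ → θ ⟨x, hx⟩ = 1 := by
  subst hN
  exact map_eq_one_of_transfer_step hp hpM hcop hQ hM θ hθ

/-- Transport of a local condition along an equality of levels. [folklore] -/
private theorem local_transport {Q : Type*} [CommGroup Q] {N N' c : ℕ} (h : N = N')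
    (P : ∀ (θ : Gamma N' →* Q),
      (∀ (g x : SL(2, ℤ)) (hx : x ∈ Gamma N') (hgx : g * x * g⁻¹ ∈ Gamma N'),
        θ ⟨g * x * g⁻¹, hgx⟩ = θ ⟨x, hx⟩) →
      ∀ (y : SL(2, ℤ)) (hy : y ∈ Gamma N'),
        y ∈ ⁅Gamma c, Gamma c⁆ ⊔ θ.ker.map (Gamma N').subtype → θ ⟨y, hy⟩ = 1)
    (θ : Gamma N →* Q)
    (hθ : ∀ (g x : SL(2, ℤ)) (hx : x ∈ Gamma N) (hgx : g * x * g⁻¹ ∈ Gamma N),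
      θ ⟨g * x * g⁻¹, hgx⟩ = θ ⟨x, hx⟩) :
    ∀ (y : SL(2, ℤ)) (hy : y ∈ Gamma N),
      y ∈ ⁅Gamma c, Gamma c⁆ ⊔ θ.ker.map (Gamma N).subtype → θ ⟨y, hy⟩ = 1 := by
  subst h
  exact P θ hθ

/-- **Block/divisor induction.**  Let `N = m·B` with `m` squarefree and prime to `B ≠ 0`, `θ : Γ(N) → Q`
invariant of prime-power exponent `ℓ^a`, and suppose the local condition holds for `Γ(m)` (a certificate for
the block `B`).  Then the local condition holds for `Γ(c)` for every `c ∣ m` (glue the cyclic/dicyclic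
certificates at the primes of `m`). [cite: CalegariDimitrovTang2025, Corollary 4.5.3] -/
theorem local_Gamma_of_squarefree_mul_block {Q : Type*} [CommGroup Q] {N m B ℓ a : ℕ} (hℓ : ℓ.Prime)
    (hN : N = m * B) (hm : Squarefree m) (hmB : m.Coprime B) (hB0 : B ≠ 0) (θ : Gamma N →* Q)
    (hθ : ∀ (g x : SL(2, ℤ)) (hx : x ∈ Gamma N) (hgx : g * x * g⁻¹ ∈ Gamma N),
      θ ⟨g * x * g⁻¹, hgx⟩ = θ ⟨x, hx⟩)
    (he : ∀ x : Gamma N, θ x ^ (ℓ ^ a) = 1)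
    (hblock : ∀ (y : SL(2, ℤ)) (hy : y ∈ Gamma N),
      y ∈ ⁅Gamma m, Gamma m⁆ ⊔ θ.ker.map (Gamma N).subtype → θ ⟨y, hy⟩ = 1) :
    ∀ (d c : ℕ), m = d * c → ∀ (y : SL(2, ℤ)) (hy : y ∈ Gamma N),
      y ∈ ⁅Gamma c, Gamma c⁆ ⊔ θ.ker.map (Gamma N).subtype → θ ⟨y, hy⟩ = 1 := by
  intro d
  induction d using Nat.strong_induction_on with
  | _ d ih =>
  intro c hdc
  have hm0 : m ≠ 0 := Squarefree.ne_zero hm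
  rcases Nat.lt_or_ge 1 d with hd1 | hd1
  swap
  · have hd : d = 1 := by
      rcases Nat.le_one_iff_eq_zero_or_eq_one.mp hd1 with h | h
      · exfalso; rw [h, zero_mul] at hdc; exact hm0 hdc
      · exact h
    rw [hd, one_mul] at hdc
    subst hdc
    exact hblock
  · obtain ⟨p, hp, hpd⟩ := Nat.exists_prime_and_dvd (show d ≠ 1 by omega)
    obtain ⟨d', rfl⟩ := hpd
    have hd'lt : d' < p * d' := by
      have hd'0 : 0 < d' := Nat.pos_of_ne_zero (by rintro rfl; simp at hd1)
      exact lt_mul_of_one_lt_left hd'0 hp.one_lt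
    have hm' : m = c * p * d' := by rw [hdc]; ring
    have hsq : Squarefree (c * p * d') := hm' ▸ hm
    have hN' : N = c * p * (d' * B) := by rw [hN, hm']; ring
    have hcop1 : (c * p).Coprime d' := Nat.coprime_of_squarefree_mul hsq
    have hcop2 : (c * p).Coprime B := Nat.Coprime.coprime_dvd_left ⟨d', hm'⟩ hmB
    have hcop : (c * p).Coprime (d' * B) := Nat.Coprime.mul_right hcop1 hcop2
    have ih₁ := ih d' hd'lt (c * p) (by rw [hm']; ring)
    have hN0 : N ≠ 0 := by rw [hN]; exact Nat.mul_ne_zero hm0 hB0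
    haveI : NeZero (c * (d' * B)) := ⟨by
      intro h0; apply hN0; rw [hN']
      rcases mul_eq_zero.mp h0 with h | h
      · simp [h]
      · rw [h, mul_zero]⟩
    have hcop' : (c * (d' * B)).Coprime p := by
      have h1 : Squarefree (c * d' * p) := by rw [show c * d' * p = c * p * d' by ring]; exact hsq
      have h2 : (c * d').Coprime p := Nat.coprime_of_squarefree_mul h1
      have h3 : B.Coprime p :=
        (Nat.Coprime.coprime_dvd_left ⟨c * d', by rw [hm']; ring⟩ hmB).symm
      rw [show c * (d' * B) = c * d' * B by ring]
      exact Nat.Coprime.mul_left h2 h3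
    have ih₂ := HcorSquarefree.local_Gamma_prime' (N := N) (m' := c * (d' * B)) (by rw [hN']; ring) hp hℓ
      hcop' θ hθ he
    exact local_Gamma_of_local_Gamma_mul' hN' hcop θ hθ ih₁ ih₂

/-- **Reduction of the `ℓ`-primary statement to block certificates at `ℓ^e`, `e ≥ 3`.**  Let `Q` be finite
commutative of exponent `ℓ^a` and suppose the block certificates at `ℓ^e` hold (for this `Q`) for all `e ≥ 3`.
Then for every `N ≠ 0` — with `4 ∤ N` if `ℓ = 2` — every invariant `θ : Γ(N) → Q` kills `Γ(12N)`.
[cite: CalegariDimitrovTang2025, Corollary 4.5.3] [cite: Beyl1986, Theorem] -/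
theorem cor453_invariant_form_of_block_certificates_exponent {ℓ a : ℕ} (hℓ : ℓ.Prime) (Q : Type u)
    [CommGroup Q] [Finite Q] (hQ : ∀ q : Q, q ^ (ℓ ^ a) = 1) :
    ∀ {N : ℕ}, N ≠ 0 → (ℓ = 2 → ¬ 4 ∣ N) →
      (∀ (e m' : ℕ), 3 ≤ e → ℓ ^ e ∣ N → m' ≠ 0 → m'.Coprime ℓ → ∀ (θ : Gamma (m' * ℓ ^ e) →* Q),
        (∀ (g x : SL(2, ℤ)) (hx : x ∈ Gamma (m' * ℓ ^ e)) (hgx : g * x * g⁻¹ ∈ Gamma (m' * ℓ ^ e)),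
          θ ⟨g * x * g⁻¹, hgx⟩ = θ ⟨x, hx⟩) →
        ∀ (y : SL(2, ℤ)) (hy : y ∈ Gamma (m' * ℓ ^ e)),
          y ∈ ⁅Gamma m', Gamma m'⁆ ⊔ θ.ker.map (Gamma (m' * ℓ ^ e)).subtype → θ ⟨y, hy⟩ = 1) →
      ∀ (θ : Gamma N →* Q),
      (∀ (g x : SL(2, ℤ)) (hx : x ∈ Gamma N) (hgx : g * x * g⁻¹ ∈ Gamma N),
        θ ⟨g * x * g⁻¹, hgx⟩ = θ ⟨x, hx⟩) →
      ∀ (x : SL(2, ℤ)) (hx : x ∈ Gamma N), x ∈ Gamma (12 * N) → θ ⟨x, hx⟩ = 1 := by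
  intro N
  induction N using Nat.strong_induction_on with
  | _ N ih =>
  intro hN0 h4 hcert θ hθ x hx hx12
  by_cases hA : ∃ p : ℕ, p.Prime ∧ p ≠ ℓ ∧ p * p ∣ N
  · obtain ⟨p, hp, hpℓ, c, hc⟩ := hA
    have hc0 : c ≠ 0 := by rintro rfl; exact hN0 (by rw [hc, mul_zero])
    haveI : NeZero (p * c) := ⟨Nat.mul_ne_zero hp.ne_zero hc0⟩
    have hNM : N = p * c * p := by rw [hc]; ring
    have hMlt : p * c < N := by
      rw [hNM]
      exact lt_mul_of_one_lt_right (Nat.pos_of_ne_zero (NeZero.ne (p * c))) hp.one_lt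
    have h4M : ℓ = 2 → ¬ 4 ∣ p * c := fun h2 h ↦ h4 h2 (h.trans ⟨p, hNM⟩)
    have hcertM := fun e m' he (hdvd : ℓ ^ e ∣ p * c) ↦ hcert e m' he (hdvd.trans ⟨p, hNM⟩)
    have hcop : (ℓ ^ a).Coprime p := Nat.Coprime.pow_left a ((Nat.coprime_primes hℓ hp).mpr hpℓ.symm)
    have hM := fun (ψ : Gamma (p * c) →* Q) hψ ↦ ih (p * c) hMlt (NeZero.ne _) h4M hcertM ψ hψ
    refine transfer_step₃ (M₀ := 12 * (p * c)) hNM hp (dvd_mul_right p c) hcop hQ hM θ hθ x hx ?_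
    exact Gamma_le_Gamma_of_dvd₉ (mul_dvd_mul_left 12 ⟨p, hNM⟩) hx12
  · push Not at hA
    -- `N = m ℓ^v` with `m` squarefree and prime to `ℓ`
    set v : ℕ := N.factorization ℓ with hv
    set m : ℕ := ordCompl[ℓ] N with hm_def
    have hNm : N = m * ℓ ^ v := by
      rw [hm_def, hv, mul_comm]; exact (Nat.ordProj_mul_ordCompl_eq_self N ℓ).symm
    have hm0 : m ≠ 0 := by intro h; apply hN0; rw [hNm, h, zero_mul]
    have hmℓ : m.Coprime ℓ := (Nat.coprime_ordCompl hℓ hN0).symm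
    have hmsq : Squarefree m := by
      rw [Nat.squarefree_iff_prime_squarefree]
      intro p hp hpm
      by_cases hpq : p = ℓ
      · subst hpq
        exact (Nat.Prime.coprime_iff_not_dvd hp).mp hmℓ.symm (dvd_trans (dvd_mul_right p p) hpm)
      · exact hA p hp hpq (hpm.trans ⟨ℓ ^ v, hNm⟩)
    have he : ∀ y : Gamma N, θ y ^ (ℓ ^ a) = 1 := fun y ↦ hQ _
    haveI : NeZero m := ⟨hm0⟩
    -- the block certificate for `Γ(m)` at `ℓ^v`
    have hblock : ∀ (y : SL(2, ℤ)) (hy : y ∈ Gamma N),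
        y ∈ ⁅Gamma m, Gamma m⁆ ⊔ θ.ker.map (Gamma N).subtype → θ ⟨y, hy⟩ = 1 := by
      rcases Nat.lt_or_ge v 3 with hv3 | hv3
      · have hcases : v = 0 ∨ v = 1 ∨ v = 2 := by omega
        rcases hcases with h0 | h1 | h2
        · -- `v = 0`: `m = N`
          rw [h0, pow_zero, mul_one] at hNm
          rw [← hNm]
          exact local_Gamma_self θ hθ
        · -- `v = 1`: the prime certificate
          rw [h1, pow_one] at hNm
          exact HcorSquarefree.local_Gamma_prime' hNm hℓ hℓ hmℓ θ hθ he
        · -- `v = 2`: the `ℓ²`-block certificate (`ℓ` odd since `4 ∤ N`)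
          rw [h2] at hNm
          have hℓ2 : ℓ ≠ 2 := by
            rintro rfl
            exact h4 rfl ⟨m, by rw [hNm]; ring⟩
          exact local_transport hNm (fun ψ hψ ↦ local_Gamma_prime_sq hℓ hℓ2 hmℓ ψ hψ (fun y ↦ hQ _)) θ hθ
      · exact local_transport hNm (hcert v m hv3 ⟨m, by rw [hNm]; ring⟩ hm0 hmℓ) θ hθ
    have hloc := local_Gamma_of_squarefree_mul_block hℓ hNm hmsq (Nat.Coprime.pow_right v hmℓ)
      (pow_ne_zero v hℓ.ne_zero) θ hθ he hblock m 1 (mul_one m).symm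
    refine hloc x hx ?_
    rw [Gamma_one_top]
    exact Subgroup.mem_sup_left
      (Subgroup.mem_inf.mp (Literature.NumberTheory.ModularForms.SL2Z.Gamma_mul_le_inf_commutator N hx12)).2

/-- **The stub modulo the odd block certificates, for `4 ∤ N`.**  Suppose that for every odd prime `p`, every
`e ≥ 3` and every finite commutative target of `p`-power exponent the block certificate at `p^e` holds.  Then
for every `N ≠ 0` with `4 ∤ N` and every finite commutative `Q`, every `SL₂(ℤ)`-invariant `θ : Γ(N) → Q` kills
`Γ(12N)`. [cite: CalegariDimitrovTang2025, Corollary 4.5.3] [cite: Beyl1986, Theorem] -/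
theorem cor453_invariant_form_of_odd_block_certificates
    (hcert : ∀ (p e m' a : ℕ), p.Prime → p ≠ 2 → 3 ≤ e → m' ≠ 0 → m'.Coprime p →
      ∀ (Q : Type u) [CommGroup Q] [Finite Q], (∀ q : Q, q ^ (p ^ a) = 1) →
      ∀ (θ : Gamma (m' * p ^ e) →* Q),
      (∀ (g x : SL(2, ℤ)) (hx : x ∈ Gamma (m' * p ^ e)) (hgx : g * x * g⁻¹ ∈ Gamma (m' * p ^ e)),
        θ ⟨g * x * g⁻¹, hgx⟩ = θ ⟨x, hx⟩) →
      ∀ (y : SL(2, ℤ)) (hy : y ∈ Gamma (m' * p ^ e)),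
        y ∈ ⁅Gamma m', Gamma m'⁆ ⊔ θ.ker.map (Gamma (m' * p ^ e)).subtype → θ ⟨y, hy⟩ = 1)
    {N : ℕ} (hN0 : N ≠ 0) (h4 : ¬ 4 ∣ N) (Q : Type u) [CommGroup Q] [Finite Q] (θ : Gamma N →* Q)
    (hθ : ∀ (g x : SL(2, ℤ)) (hx : x ∈ Gamma N) (hgx : g * x * g⁻¹ ∈ Gamma N),
      θ ⟨g * x * g⁻¹, hgx⟩ = θ ⟨x, hx⟩) :
    ∀ (x : SL(2, ℤ)) (hx : x ∈ Gamma N), x ∈ Gamma (12 * N) → θ ⟨x, hx⟩ = 1 := by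
  intro x hx hx12
  set n : ℕ := Nat.card Q with hn
  have hn0 : n ≠ 0 := Nat.card_pos.ne'
  by_contra hne
  have hord : orderOf (θ ⟨x, hx⟩) ≠ 1 := fun h1 ↦ hne (orderOf_eq_one_iff.mp h1)
  obtain ⟨ℓ, hℓ, hℓq⟩ := Nat.exists_prime_and_dvd hord
  have hℓn : ℓ ∣ n := hℓq.trans (orderOf_dvd_of_pow_eq_one (hn ▸ pow_card_eq_one'))
  -- corestriction to the `ℓ`-power torsion
  set m : ℕ := ordCompl[ℓ] n with hm_def
  have hnm : ordProj[ℓ] n * m = n := Nat.ordProj_mul_ordCompl_eq_self n ℓ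
  have hpow : ∀ (y : Gamma N), ((powMonoidHom m).comp θ) y = θ y ^ m := fun y ↦ rfl
  have he : ∀ y : Gamma N, ((powMonoidHom m).comp θ) y ^ (ℓ ^ n.factorization ℓ) = 1 := by
    intro y
    rw [hpow, ← pow_mul, mul_comm, hnm, hn]
    exact pow_card_eq_one'
  set T : Subgroup Q := (powMonoidHom (ℓ ^ n.factorization ℓ) : Q →* Q).ker with hT
  set θT : Gamma N →* T := ((powMonoidHom m).comp θ).codRestrict T
    (fun y ↦ by rw [hT, MonoidHom.mem_ker, powMonoidHom_apply]; exact he y) with hθT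
  have hθTval : ∀ y : Gamma N, ((θT y : T) : Q) = θ y ^ m := fun y ↦ rfl
  have hQT : ∀ q : T, q ^ (ℓ ^ n.factorization ℓ) = 1 := by
    intro q
    apply Subtype.ext
    have hq : (q : Q) ∈ (powMonoidHom (ℓ ^ n.factorization ℓ) : Q →* Q).ker := q.2
    rw [MonoidHom.mem_ker, powMonoidHom_apply] at hq
    rw [Subgroup.coe_pow, Subgroup.coe_one]
    exact hq
  have hθTinv : ∀ (g y : SL(2, ℤ)) (hy : y ∈ Gamma N) (hgy : g * y * g⁻¹ ∈ Gamma N),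
      θT ⟨g * y * g⁻¹, hgy⟩ = θT ⟨y, hy⟩ := by
    intro g y hy hgy
    apply Subtype.ext
    rw [hθTval, hθTval, hθ g y hy hgy]
  have key : θ ⟨x, hx⟩ ^ m = 1 := by
    have hcertT : ∀ (e m' : ℕ), 3 ≤ e → ℓ ^ e ∣ N → m' ≠ 0 → m'.Coprime ℓ →
        ∀ (ψ : Gamma (m' * ℓ ^ e) →* T),
        (∀ (g x : SL(2, ℤ)) (hx : x ∈ Gamma (m' * ℓ ^ e)) (hgx : g * x * g⁻¹ ∈ Gamma (m' * ℓ ^ e)),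
          ψ ⟨g * x * g⁻¹, hgx⟩ = ψ ⟨x, hx⟩) →
        ∀ (y : SL(2, ℤ)) (hy : y ∈ Gamma (m' * ℓ ^ e)),
          y ∈ ⁅Gamma m', Gamma m'⁆ ⊔ ψ.ker.map (Gamma (m' * ℓ ^ e)).subtype → ψ ⟨y, hy⟩ = 1 := by
      intro e m' he3 hdvd hm'0 hm'ℓ ψ hψ
      have hℓ2 : ℓ ≠ 2 := by
        rintro rfl
        exact h4 (dvd_trans (pow_dvd_pow 2 (by omega : 2 ≤ e)) hdvd)
      exact hcert ℓ e m' (n.factorization ℓ) hℓ hℓ2 he3 hm'0 hm'ℓ T hQT ψ hψ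
    have h1 := cor453_invariant_form_of_block_certificates_exponent hℓ T hQT hN0 (fun _ ↦ h4) hcertT θT
      hθTinv x hx hx12
    have h2 := congrArg Subtype.val h1
    rw [hθTval, Subgroup.coe_one] at h2
    exact h2
  have h1 : ℓ ∣ ordCompl[ℓ] n := hℓq.trans (orderOf_dvd_of_pow_eq_one key)
  exact hℓ.one_lt.ne' (Nat.Coprime.eq_one_of_dvd (Nat.coprime_ordCompl hℓ hn0) h1)

end HcorBlocks

end Summit.BirchSwinnertonDyer.BirchSwinnertonDyer.Theorems
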